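import Summits.BirchSwinnertonDyer.BirchSwinnertonDyer.Theorems.GenusKolyvaginAtTwoPowDvdShaCardAtTwoRTHeegnerTwinTamagawaValuation
import Summits.BirchSwinnertonDyer.BirchSwinnertonDyer.Theorems.GenusKolyvaginAtTwoGenusPrimitiveSupplyAtTwoTwinSelmerBound
import Summits.BirchSwinnertonDyer.BirchSwinnertonDyer.Theorems.GenusKolyvaginAtTwoGenusPrimitiveSupplyAtTwoLocalTwoTorsion
import Summits.BirchSwinnertonDyer.BirchSwinnertonDyer.Theorems.GenusKolyvaginAtTwoMazurRubinProp33
import HarnessLib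

/-!
# Route `GenusKolyvaginAtTwo`, crux #2 `GenusPrimitiveSupplyAtTwo` (stmt-BirchSwinnertonDyer-22136):
# THE REACH OF THE HABITAT CUT (E1) — a `2`-Selmer-minimal Heegner twin of genus budget `ord₂ C(Wd) = 1` forces `#Sel₂(W) ∣ 4`, UNCONDITIONALLY

Width seat `bsd-line-gk2-p5` g20 (cell `bsd-f1-sign2`, SUPPLY lineage), companion of `…GenusPrimitiveSupplyAtTwoHabitatCutSupply` (the supply
DELIVERS (E1) for `#Sel₂(W) ∈ {1, 4}`). THEOREMS ONLY (no definition, no named fact, no `sorry`); helper `--supports stmt-BirchSwinnertonDyer-22136`;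
no item is closed; BSD is not proved by any of this.

WHY. LINE 18's consensus habitat cut is (E1) «`B := ord₂ C(Wd) = 1`» for the Heegner twin `Wd ≅ W^{(d_K)}` (it voids the Deep stub and the bottom-rung
residual R⁽¹⁾; LEAD memos g16 §5, g17). This file records the CONVERSE of the supply theorem in the same currency, so that the pen can see the
exact reach of (E1): by gk2-p3's place-by-place formula `ord₂ C(Wd) = ord₂ C(W) + Σ_{q ∣ d_K} ord₂(1 + #roots of ψ mod q)`
(`PlusDescent.padicValNat_two_tamagawaProduct_twin_eq`) and `1 + #roots = 2^{ord₂(1 + #roots)}` (`PlusDescent.one_add_card_roots_eq_two_pow`), on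
`C(W)` odd the budget `B = 1` means EXACTLY ONE prime `q₀ ∣ d_K` with one root of `ψ` mod `q₀` (a transposition prime, `#W(ℚ_{q₀})[2] = 2`) and
NO root at every other prime of `d_K` (silent, `W(ℚ_p)[2] = 0`) — `DEF(W, K) = 1` in the local-`2`-torsion currency of Mazur–Rubin's Prop. 3.3
(gk2-p5 `GenusKolyTwin.natCard_twoTorsion_padic_eq_two_of_existsUnique` / `twoTorsion_padic_eq_zero_of_forall_ne`). Then gk2-p4 g6's
`GenusKoly.natCard_selmerGroup_two_dvd_four_of_minimalTwin_of_prop33`, with `MazurRubin2010.prop33_rat` now a TREE THEOREM (gk2-p4 g12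
`MazurRubin2010.prop33_rat_holds`), gives `#Sel₂(W) ∣ 4` whenever the twin is `2`-Selmer-minimal.

* §1 `natCard_selmerGroup_two_dvd_four_of_minimalTwin` — gk2-p4 g6's `…_of_prop33` with `prop33_rat` DISCHARGED (unconditional).
* §2 `exists_transposition_prime_of_padicValNat_two_tamagawaProduct_twin_eq_one` — (E1) with `C(W)` odd ⟹ `DEF(W,K) = 1`: a prime `q₀ ∣ d_K` with
  `#W(ℚ_{q₀})[2] = 2` and `W(ℚ_p)[2] = 0` at every other prime `p ∣ d_K`.
* §3 **`natCard_selmerGroup_two_dvd_four_of_genusBudget_one`** — `W/ℚ` globally minimal elliptic, `C(W)` odd, `Δ_W < 0`, `K` imaginary quadratic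
  with odd `d_K`, Heegner for `N_W`, `2` split; `Wd` a model of `W^{(d_K)}` with `#Sel₂(Wd) = 2` and `ord₂ C(Wd) = 1` ⟹ **`#Sel₂(W) ∣ 4`**.
  READING for the pen: under (E1) the line reaches EXACTLY the curves with `dim Sel₂(W) ≤ 2` (on the habitat: `Ш(W)[2] ≤ (ℤ/2)²`) — where, conversely,
  the supply delivers (E1) (`…HabitatCutSupply`); every row of the X5 `Δ < 0` instrument has `dim Sel₂(W) = 2`.

References: [MazurRubin2010] Prop. 3.3, Lemma 2.2 (i); [Kramer1981] §2 Prop. 3; [SilvermanAEC2009] VII.3 Prop. 3.1(b); [GrossLMS1991] §1.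
-/

set_option linter.dupNamespace false -- tree convention: `Summit.BirchSwinnertonDyer.BirchSwinnertonDyer.Theorems` (summit = sub-problem)
set_option autoImplicit false

noncomputable section

open scoped Classical

namespace Summit.BirchSwinnertonDyer.BirchSwinnertonDyer.Theorems.GenusKolyTwin

open WeierstrassCurve NumberField Literature.NumberTheory.EllipticCurves
open Literature.NumberTheory.EllipticCurves.MazurRubin2010
open Summit.BirchSwinnertonDyer.BirchSwinnertonDyer.Theorems.GenusExact.PlusDescent
  (padicValNat_two_tamagawaProduct_twin_eq one_add_card_roots_eq_two_pow)

variable (W : WeierstrassCurve ℚ) [W.IsElliptic]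

/-! ## §1 `DEF = 1` + minimal twin ⟹ `#Sel₂(W) ∣ 4`, unconditionally -/

/-- **`#Sel₂(Wd) = 2 ⟹ #Sel₂(W) ∣ 4` at a `DEF = 1` Heegner field (`Δ_W < 0`), UNCONDITIONALLY** — gk2-p4 g6's
`GenusKoly.natCard_selmerGroup_two_dvd_four_of_minimalTwin_of_prop33` with Mazur–Rubin Prop. 3.3 over `ℚ` DISCHARGED by the tree theorem
`MazurRubin2010.prop33_rat_holds`. Local-`2`-torsion currency: one prime `q ∣ d_K` with `#W(ℚ_q)[2] = 2`, `W(ℚ_p)[2] = 0` at every other `p ∣ d_K`.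
[cite: MazurRubin2010, Prop. 3.3 with Lemma 2.2 (i)] -/
theorem natCard_selmerGroup_two_dvd_four_of_minimalTwin (hΔ : W.Δ < 0)
    {K : Type} [Field K] [NumberField K] (hK : IsImaginaryQuadratic K) (hodd : Odd (NumberField.discr K))
    (hH : SatisfiesHeegnerHypothesis (W.conductorNorm ℤ) K)
    (h2 : ((Ideal.span {(2 : ℤ)}).primesOver (𝓞 K)).ncard = 2)
    (q : ℕ) [Fact q.Prime] (hq : (q : ℤ) ∣ NumberField.discr K)
    (hq2 : Nat.card {Q : (W.baseChange ℚ_[q]).toAffine.Point // 2 • Q = 0} = 2)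
    (hT : ∀ (p : ℕ) [Fact p.Prime], (p : ℤ) ∣ NumberField.discr K → p ≠ q →
      ∀ Q : (W.baseChange ℚ_[p]).toAffine.Point, 2 • Q = 0 → Q = 0)
    (Wd : WeierstrassCurve ℚ) [Wd.IsElliptic]
    (hWd : ∃ C : VariableChange ℚ, C • W.quadraticTwist (NumberField.discr K : ℚ) = Wd)
    (hSel : Nat.card (Wd.selmerGroup 2) = 2) :
    Nat.card (W.selmerGroup 2) ∣ 4 :=
  GenusKoly.natCard_selmerGroup_two_dvd_four_of_minimalTwin_of_prop33 prop33_rat_holds W hΔ hK hodd hH h2 q hq hq2 hT Wd hWd hSel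

/-! ## §2 (E1) with `C(W)` odd ⟹ `DEF(W, K) = 1` -/

variable [W.IsGloballyMinimal]

omit [W.IsElliptic] in
/-- The root set of the `2`-division cubic mod `q` as a `Finset.filter`. [folklore] -/
private theorem ncard_roots_eq_card_filter (q : ℕ) [Fact q.Prime] :
    {x : ZMod q | 4 * x ^ 3 + ((integralModelInt W).b₂ : ZMod q) * x ^ 2 +
        2 * ((integralModelInt W).b₄ : ZMod q) * x + ((integralModelInt W).b₆ : ZMod q) = 0}.ncard =
      (Finset.univ.filter fun x : ZMod q =>
        4 * x ^ 3 + ((integralModelInt W).b₂ : ZMod q) * x ^ 2 +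
          2 * ((integralModelInt W).b₄ : ZMod q) * x + ((integralModelInt W).b₆ : ZMod q) = 0).card := by
  rw [← Set.ncard_coe_finset]
  congr 1
  ext x
  simp

/-- At a prime `q ∣ d_K` of a Heegner field with odd `d_K`: `q ≠ 2` and `q ∤ Δ_min(W)`. [cite: GrossLMS1991, §1 (Heegner hypothesis)] -/
private theorem ne_two_and_not_dvd_minimalDiscriminantInt_of_dvd_discr
    {K : Type} [Field K] [NumberField K] (hK : IsImaginaryQuadratic K) (hodd : Odd (NumberField.discr K))
    (hH : SatisfiesHeegnerHypothesis (W.conductorNorm ℤ) K) {q : ℕ} (hqP : q.Prime) (hq : (q : ℤ) ∣ NumberField.discr K) :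
    q ≠ 2 ∧ ¬ (q : ℤ) ∣ minimalDiscriminantInt W := by
  refine ⟨?_, fun hqΔ ↦ ?_⟩
  · rintro rfl
    exact (Int.not_even_iff_odd.mpr hodd) (even_iff_two_dvd.mpr (by exact_mod_cast hq))
  · exact Literature.SatisfiesHeegnerHypothesis.not_dvd_discr hK.1 hH hqP
      (dvd_conductorNorm_of_dvd_minimalDiscriminantInt W hqP hqΔ) hq

/-- **(E1) ⟹ `DEF(W, K) = 1`.** `W/ℚ` globally minimal elliptic with `C(W)` odd; `K` imaginary quadratic with odd `d_K` satisfying the Heegner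
hypothesis for `N_W`; `Wd = Cd • W^{(d_K)}` with genus budget `ord₂ C(Wd) = 1`. Then there is a prime `q₀ ∣ d_K` with `#W(ℚ_{q₀})[2] = 2`
(exactly one root of `ψ` mod `q₀`) while `W(ℚ_p)[2] = 0` at every other prime `p ∣ d_K` (no root): the one bit of the budget sits at one prime.
Proof: `1 = ord₂ C(Wd) = ord₂ C(W) + Σ_{q ∣ d_K} ord₂(1 + #roots_q) = Σ_q ord₂(1 + #roots_q)`, each summand `≥ 0`, so exactly one summand is `1` and the
others are `0`; and `1 + #roots_q = 2^{ord₂(1 + #roots_q)}`. [cite: Kramer1981, §2 Prop. 3] [cite: MazurRubin2010, Lemma 2.2 (i)]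
[cite: SilvermanAEC2009, VII.3 Prop. 3.1(b)] -/
theorem exists_transposition_prime_of_padicValNat_two_tamagawaProduct_twin_eq_one
    {K : Type} [Field K] [NumberField K] (hK : IsImaginaryQuadratic K) (hodd : Odd (NumberField.discr K))
    (hH : SatisfiesHeegnerHypothesis (W.conductorNorm ℤ) K) (hTam : Odd W.tamagawaProduct)
    {Wd : WeierstrassCurve ℚ} [Wd.IsElliptic] (Cd : VariableChange ℚ) (hWd : Cd • W.quadraticTwist (NumberField.discr K : ℚ) = Wd)
    (hB : padicValNat 2 Wd.tamagawaProduct = 1) :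
    ∃ (q₀ : ℕ) (_ : Fact q₀.Prime), (q₀ : ℤ) ∣ NumberField.discr K ∧
      Nat.card {Q : (W.baseChange ℚ_[q₀]).toAffine.Point // 2 • Q = 0} = 2 ∧
      ∀ (p : ℕ) [Fact p.Prime], (p : ℤ) ∣ NumberField.discr K → p ≠ q₀ →
        ∀ Q : (W.baseChange ℚ_[p]).toAffine.Point, 2 • Q = 0 → Q = 0 := by
  haveI : Fact (Nat.Prime 2) := ⟨Nat.prime_two⟩
  set S := (NumberField.discr K).natAbs.primeFactors with hS
  -- the budget at a prime `q`
  set f : ℕ → ℕ := fun q ↦ padicValNat 2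
    ({x : ZMod q | 4 * x ^ 3 + ((integralModelInt W).b₂ : ZMod q) * x ^ 2 +
      2 * ((integralModelInt W).b₄ : ZMod q) * x + ((integralModelInt W).b₆ : ZMod q) = 0}.ncard + 1) with hf
  have hW0 : padicValNat 2 W.tamagawaProduct = 0 :=
    padicValNat.eq_zero_of_not_dvd fun h ↦ (Nat.not_even_iff_odd.mpr hTam) (even_iff_two_dvd.mpr h)
  have hsum : ∑ q ∈ S, f q = 1 := by
    have h := padicValNat_two_tamagawaProduct_twin_eq W hK hodd hH Cd hWd
    rw [hB, hW0, zero_add] at h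
    exact h.symm
  -- exactly one prime carries the bit
  have hex : ∃ q₀ ∈ S, f q₀ ≠ 0 := by
    by_contra h
    push Not at h
    rw [Finset.sum_eq_zero h] at hsum
    exact zero_ne_one hsum
  obtain ⟨q₀, hq₀S, hq₀⟩ := hex
  have hle : ∀ q ∈ S, f q ≤ 1 := fun q hq ↦ hsum ▸ Finset.single_le_sum (fun _ _ ↦ Nat.zero_le _) hq
  have hf₀ : f q₀ = 1 := le_antisymm (hle q₀ hq₀S) (Nat.one_le_iff_ne_zero.mpr hq₀)
  have hothers : ∀ q ∈ S, q ≠ q₀ → f q = 0 := by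
    intro q hq hne
    have hpair : ∑ x ∈ ({q, q₀} : Finset ℕ), f x ≤ ∑ x ∈ S, f x :=
      Finset.sum_le_sum_of_subset_of_nonneg (by
        intro x hx
        rcases Finset.mem_insert.mp hx with rfl | hx
        · exact hq
        · rwa [Finset.mem_singleton.mp hx]) (fun _ _ _ ↦ Nat.zero_le _)
    rw [Finset.sum_pair hne, hsum, hf₀] at hpair
    omega
  -- membership in `S` ↔ a prime dividing `d_K`
  have hd0 : (NumberField.discr K).natAbs ≠ 0 := Int.natAbs_ne_zero.mpr (NumberField.discr_ne_zero K)
  have hmemS : ∀ {p : ℕ}, p.Prime → ((p : ℤ) ∣ NumberField.discr K ↔ p ∈ S) := fun {p} hp ↦ by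
    rw [hS, Nat.mem_primeFactors, Int.natCast_dvd]
    exact ⟨fun h ↦ ⟨hp, h, hd0⟩, fun h ↦ h.2.1⟩
  have hq₀P : q₀.Prime := (Nat.mem_primeFactors.mp hq₀S).1
  haveI : Fact q₀.Prime := ⟨hq₀P⟩
  have hq₀d : (q₀ : ℤ) ∣ NumberField.discr K := (hmemS hq₀P).mpr hq₀S
  -- from the budget to root counts: `1 + #roots = 2^{budget}`
  have hroots : ∀ {q : ℕ} (hqF : Fact q.Prime), (q : ℤ) ∣ NumberField.discr K →
      1 + (Finset.univ.filter fun x : ZMod q =>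
        4 * x ^ 3 + ((integralModelInt W).b₂ : ZMod q) * x ^ 2 +
          2 * ((integralModelInt W).b₄ : ZMod q) * x + ((integralModelInt W).b₆ : ZMod q) = 0).card = 2 ^ f q := by
    intro q hqF hqd
    obtain ⟨hq2, hqΔ⟩ := ne_two_and_not_dvd_minimalDiscriminantInt_of_dvd_discr W hK hodd hH hqF.out hqd
    have h := one_add_card_roots_eq_two_pow W hq2 hqΔ
    rw [hf]
    dsimp only
    rw [ncard_roots_eq_card_filter W q, add_comm _ 1]
    exact h
  refine ⟨q₀, inferInstance, hq₀d, ?_, fun p _ hpd hpne ↦ ?_⟩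
  · -- the transposition prime
    obtain ⟨hq2, hqΔ⟩ := ne_two_and_not_dvd_minimalDiscriminantInt_of_dvd_discr W hK hodd hH hq₀P hq₀d
    have hcard : (Finset.univ.filter fun x : ZMod q₀ =>
        4 * x ^ 3 + ((integralModelInt W).b₂ : ZMod q₀) * x ^ 2 +
          2 * ((integralModelInt W).b₄ : ZMod q₀) * x + ((integralModelInt W).b₆ : ZMod q₀) = 0).card = 1 := by
      have h := hroots (q := q₀) inferInstance hq₀d
      rw [hf₀, pow_one] at h
      omega
    obtain ⟨x₀, hx₀⟩ := Finset.card_eq_one.mp hcard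
    refine natCard_twoTorsion_padic_eq_two_of_existsUnique W hq2 hqΔ ⟨x₀, ?_, fun y hy ↦ ?_⟩
    · have : x₀ ∈ (Finset.univ.filter fun x : ZMod q₀ =>
          4 * x ^ 3 + ((integralModelInt W).b₂ : ZMod q₀) * x ^ 2 +
            2 * ((integralModelInt W).b₄ : ZMod q₀) * x + ((integralModelInt W).b₆ : ZMod q₀) = 0) := by
        rw [hx₀]; exact Finset.mem_singleton_self x₀
      exact (Finset.mem_filter.mp this).2
    · have : y ∈ (Finset.univ.filter fun x : ZMod q₀ =>
          4 * x ^ 3 + ((integralModelInt W).b₂ : ZMod q₀) * x ^ 2 +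
            2 * ((integralModelInt W).b₄ : ZMod q₀) * x + ((integralModelInt W).b₆ : ZMod q₀) = 0) :=
        Finset.mem_filter.mpr ⟨Finset.mem_univ y, hy⟩
      rw [hx₀] at this
      exact Finset.mem_singleton.mp this
  · -- a silent prime
    have hpP : p.Prime := Fact.out
    obtain ⟨hp2, hpΔ⟩ := ne_two_and_not_dvd_minimalDiscriminantInt_of_dvd_discr W hK hodd hH hpP hpd
    have hfp : f p = 0 := hothers p ((hmemS hpP).mp hpd) hpne
    have hcard : (Finset.univ.filter fun x : ZMod p =>
        4 * x ^ 3 + ((integralModelInt W).b₂ : ZMod p) * x ^ 2 +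
          2 * ((integralModelInt W).b₄ : ZMod p) * x + ((integralModelInt W).b₆ : ZMod p) = 0).card = 0 := by
      have h := hroots (q := p) inferInstance hpd
      rw [hfp, pow_zero] at h
      omega
    refine twoTorsion_padic_eq_zero_of_forall_ne W hp2 hpΔ fun x hx ↦ ?_
    have hmem : x ∈ (Finset.univ.filter fun x : ZMod p =>
        4 * x ^ 3 + ((integralModelInt W).b₂ : ZMod p) * x ^ 2 +
          2 * ((integralModelInt W).b₄ : ZMod p) * x + ((integralModelInt W).b₆ : ZMod p) = 0) :=
      Finset.mem_filter.mpr ⟨Finset.mem_univ x, hx⟩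
    rw [Finset.card_eq_zero.mp hcard] at hmem
    exact Finset.notMem_empty x hmem

/-! ## §3 The reach of (E1) -/

/-- **THE REACH OF THE HABITAT CUT (E1): `ord₂ C(Wd) = 1` and `#Sel₂(Wd) = 2` force `#Sel₂(W) ∣ 4`, UNCONDITIONALLY.** `W/ℚ` globally minimal
elliptic with `C(W)` odd and `Δ_W < 0`; `K` imaginary quadratic with odd `d_K`, the Heegner hypothesis for `N_W` and `2` split; `Wd` a model of
`W^{(d_K)}` with `#Sel₂(Wd) = 2` and genus budget `ord₂ C(Wd) = 1`. Then `#Sel₂(W) ∣ 4`, i.e. `dim_𝔽₂ Sel₂(W) ≤ 2` (on the rank-`0` habitat: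
`Ш(W)[2] ≤ (ℤ/2)²`). With `…HabitatCutSupply` (the supply DELIVERS such `(K, Wd)` whenever `#Sel₂(W) ∈ {1, 4}`) this pins the reach of LINE 18 under
(E1) to `dim Sel₂(W) ≤ 2` — every row of the X5 `Δ < 0` instrument. [cite: MazurRubin2010, Prop. 3.3 with Lemma 2.2 (i)] [cite: Kramer1981, §2 Prop. 3] -/
theorem natCard_selmerGroup_two_dvd_four_of_genusBudget_one (hΔ : W.Δ < 0) (hTam : Odd W.tamagawaProduct)
    {K : Type} [Field K] [NumberField K] (hK : IsImaginaryQuadratic K) (hodd : Odd (NumberField.discr K))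
    (hH : SatisfiesHeegnerHypothesis (W.conductorNorm ℤ) K)
    (h2 : ((Ideal.span {(2 : ℤ)}).primesOver (𝓞 K)).ncard = 2)
    (Wd : WeierstrassCurve ℚ) [Wd.IsElliptic]
    (hWd : ∃ C : VariableChange ℚ, C • W.quadraticTwist (NumberField.discr K : ℚ) = Wd)
    (hSel : Nat.card (Wd.selmerGroup 2) = 2) (hB : padicValNat 2 Wd.tamagawaProduct = 1) :
    Nat.card (W.selmerGroup 2) ∣ 4 := by
  obtain ⟨Cd, hCd⟩ := hWd
  obtain ⟨q₀, hq₀F, hq₀d, hq₀2, hT⟩ :=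
    exists_transposition_prime_of_padicValNat_two_tamagawaProduct_twin_eq_one W hK hodd hH hTam Cd hCd hB
  exact natCard_selmerGroup_two_dvd_four_of_minimalTwin W hΔ hK hodd hH h2 q₀ hq₀d hq₀2 hT Wd ⟨Cd, hCd⟩ hSel

/-- **The `2 ∣ N_W` form** (then `2` splits in every Heegner field automatically). [cite: MazurRubin2010, Prop. 3.3] [cite: GrossLMS1991, §1] -/
theorem natCard_selmerGroup_two_dvd_four_of_genusBudget_one_of_two_dvd_conductorNorm (hΔ : W.Δ < 0) (hTam : Odd W.tamagawaProduct)
    (hN2 : 2 ∣ W.conductorNorm ℤ)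
    {K : Type} [Field K] [NumberField K] (hK : IsImaginaryQuadratic K) (hodd : Odd (NumberField.discr K))
    (hH : SatisfiesHeegnerHypothesis (W.conductorNorm ℤ) K)
    (Wd : WeierstrassCurve ℚ) [Wd.IsElliptic]
    (hWd : ∃ C : VariableChange ℚ, C • W.quadraticTwist (NumberField.discr K : ℚ) = Wd)
    (hSel : Nat.card (Wd.selmerGroup 2) = 2) (hB : padicValNat 2 Wd.tamagawaProduct = 1) :
    Nat.card (W.selmerGroup 2) ∣ 4 :=
  natCard_selmerGroup_two_dvd_four_of_genusBudget_one W hΔ hTam hK hodd hH (hH 2 Nat.prime_two hN2) Wd hWd hSel hB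

end Summit.BirchSwinnertonDyer.BirchSwinnertonDyer.Theorems.GenusKolyTwin

end
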